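import Literature.AlgebraicGeometry.Frobenioids.FrobenioidRealificationCanonical
import Literature.AlgebraicGeometry.Frobenioids.RealificationNatTrans
import Literature.AlgebraicGeometry.Frobenioids.MonoidFunctorsOnD
import Literature.AlgebraicGeometry.Frobenioids.ElementaryPreFrobenioid

/-!
# Frobenioids I, Prop. 5.3: "the divisor monoid `Φ^rlf`" and "the rational function monoid `ℝ · Φ^birat`" ARE
# monoids on `D` — under divisibility-reflecting pull-backs (PROOFS; cell sub-DAG W3, rows P53/L02a, P53/L02c)

Mochizuki, *The geometry of Frobenioids I: the general theory*, Kyushu J. Math. **62** (2008) 293–400, §5,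
Proposition 5.3, kurims p. 103 ll. 9–16: "we shall refer to as the realification `C^rlf` of the Frobenioid `C`
the model Frobenioid [cf. Theorem 5.2, (ii)] associated to the divisor monoid `Φ^rlf` … and the rational
function monoid `ℝ · Φ^birat ⊆ (Φ^rlf)^gp`" [cite: MochizukiFrdI2008, Prop. 5.3 p.103]; Def. 2.4 (i) p. 48 for
`M^rlf` [cite: MochizukiFrdI2008, Def. 2.4 (i) p.48].  For Thm. 5.2 (ii) to apply, `Φ^rlf` must be a divisorial
MONOID ON `D` and `ℝ · Φ^birat` a group-like MONOID ON `D` (Def. 1.1 (ii): characteristically injective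
pull-backs, isomorphisms along FSM-morphisms) — implicit in print.

PROOF-ONLY (theorems, no `def`; cell abc-iut, L1 sub-DAG W3, seat abc-iut-w5-d137; the named rows live in the
statements file `Prop53Sub.lean`, whose slots these theorems fill):

* `Perfection.dvd_of_map_dvd_of_reflects` — divisibility reflection passes from `f : M → N` to `f^pf`;
* `IsPerfFactorial.Rlf.map_injective_of_reflects` — for perf-factorial `M`, `N` and an injective `f : M → N`
  REFLECTING divisibility, `f^rlf : M^rlf → N^rlf` (`IsPerfFactorial.Rlf.map`, seat abc-iut-L1-d2) is injective:
  the image of `M^pf → N^pf → N^rlf` is group-saturated, so the order-reflection argument of [EtTh] Lem. 3.5 (i)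
  (`RlfUniversal.lift_injective`, seat abc-iut-L2-d2) applies.  FINDING P53-F1 (seat abc-iut-L1-d2, cell INBOX
  2026-08-26T00:36:52Z): WITHOUT divisibility reflection this is FALSE — `f : ℕ² → ℝ_{≥0}`, `(a, b) ↦ a + b√2` is
  characteristically injective with `f^rlf : ℝ_{≥0}² → ℝ_{≥0}` not injective; print's "the divisor monoid `Φ^rlf`"
  silently uses that the pull-backs of the divisor monoids in the motivating examples pull divisors back prime
  by prime (hence reflect divisibility);
* `IsPerfFactorial.Rlf.map_bijective_of_bijective` — `f` bijective ⇒ `f^rlf` bijective (functoriality);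
* `isMonoidOn_rlfFunctor_of_reflects` — **`Φ^rlf` is a monoid on `D`** for a perf-factorial monoid `Φ` on `D`
  with divisibility-reflecting pull-backs (row P53/L02a);
* `RealificationData.isMonoidOn_realSpan` — **`ℝ · Ψ` is a monoid on `D`** for ANY realification datum `R` with
  `Φ^rlf` an integral monoid on `D` and any subfunctor of groups `Ψ ⊆ Φ^gp` with FSM-surjective pull-backs
  (row P53/L02c): injectivity inherited from `(Φ^rlf)^gp`, trivial `Associates` of a group, surjectivity along
  FSM-morphisms from that of `Ψ` by the `ℝ`-linearity `pullGp_rsmul` on the generators `r • ι(c)`.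

Standard axioms only; nothing here bears on [IUTchIII] Cor. 3.12.
-/

noncomputable section

namespace Literature.AlgebraicGeometry.Frobenioids

open CategoryTheory Opposite Function Literature.AnabelianGeometry.EtaleTheta

universe w v u

/-! ### Divisibility reflection passes to the perfection -/

namespace Perfection

variable {M N : Type w} [CommMonoid M] [CommMonoid N]

/-- `of u ∣ of v` in `N^pf` forces `u^k ∣ v^k` in `N` for some `k ≥ 1`. [cite: MochizukiFrdI2008, §0 p.11] -/
theorem exists_pow_dvd_pow_of_of_dvd_of {u v : N} (h : Perfection.of N u ∣ Perfection.of N v) :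
    ∃ k : ℕ+, u ^ (k : ℕ) ∣ v ^ (k : ℕ) := by
  obtain ⟨w, hw⟩ := h
  obtain ⟨⟨c, k⟩, rfl⟩ := Perfection.mk_surjective w
  change Perfection.mk v 1 = Perfection.mk u 1 * Perfection.mk c k at hw
  rw [Perfection.mk_mul_mk, Perfection.mk_eq_mk_iff] at hw
  obtain ⟨K, hK⟩ := hw
  refine ⟨K * k, c ^ (K : ℕ), ?_⟩
  simp only [PNat.one_coe, one_mul, mul_one, pow_one, mul_pow, ← pow_mul] at hK
  rw [PNat.mul_coe, hK, mul_comm (k : ℕ) (K : ℕ)]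

/-- **Divisibility reflection passes to the perfection**: if `f : M → N` reflects divisibility, so does
`f^pf : M^pf → N^pf` (roots are unique in the perfect monoid `M^pf`). [cite: MochizukiFrdI2008, §0 p.11] -/
theorem dvd_of_map_dvd_of_reflects (f : M →* N) (hrefl : ∀ a b : M, f a ∣ f b → a ∣ b)
    {x y : Perfection M} (h : Perfection.map f x ∣ Perfection.map f y) : x ∣ y := by
  obtain ⟨⟨a, n⟩, rfl⟩ := Perfection.mk_surjective x
  obtain ⟨⟨b, m⟩, rfl⟩ := Perfection.mk_surjective y
  change Perfection.mk a n ∣ Perfection.mk b m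
  change Perfection.map f (Perfection.mk a n) ∣ Perfection.map f (Perfection.mk b m) at h
  -- raise to the power `n·m`: both sides land in the image of `N → N^pf`
  have hx : Perfection.mk a n ^ ((n : ℕ) * (m : ℕ)) = Perfection.of M (a ^ (m : ℕ)) := by
    rw [pow_mul, Perfection.mk_pow_self, map_pow]
  have hy : Perfection.mk b m ^ ((n : ℕ) * (m : ℕ)) = Perfection.of M (b ^ (n : ℕ)) := by
    rw [mul_comm, pow_mul, Perfection.mk_pow_self, map_pow]
  have h' : Perfection.of N (f (a ^ (m : ℕ))) ∣ Perfection.of N (f (b ^ (n : ℕ))) := by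
    have := pow_dvd_pow_of_dvd h ((n : ℕ) * (m : ℕ))
    rw [← map_pow, ← map_pow, hx, hy] at this
    simpa only [Perfection.map_mk, Perfection.of_apply] using this
  obtain ⟨k, hk⟩ := exists_pow_dvd_pow_of_of_dvd_of h'
  rw [← map_pow, ← map_pow] at hk
  obtain ⟨d, hd⟩ := hrefl _ _ hk
  -- `y = x · d^{1/J}` with `J = n·m·k`, by injectivity of `J`-th powers in `M^pf`
  let J : ℕ+ := n * m * k
  refine ⟨Perfection.mk d J, ?_⟩
  apply (isPerfect_perfection.bijective_pow (J : ℕ) J.pos).1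
  change Perfection.mk b m ^ (J : ℕ) = (Perfection.mk a n * Perfection.mk d J) ^ (J : ℕ)
  rw [pow_mul] at hx hy
  rw [mul_pow, Perfection.mk_pow_self, show ((J : ℕ+) : ℕ) = (n : ℕ) * (m : ℕ) * (k : ℕ) by rfl]
  simp only [pow_mul]
  rw [hx, hy, ← map_pow, ← map_pow, hd, map_mul]

end Perfection

/-! ### `f^rlf` is injective when `f` is injective and reflects divisibility; bijective when `f` is -/

/-- `e⁻¹ ∘ e = id` for a multiplicative equivalence, as monoid homomorphisms. [folklore] -/
private theorem mulEquiv_symm_comp_toMonoidHom {M N : Type w} [CommMonoid M] [CommMonoid N] (e : M ≃* N) :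
    e.symm.toMonoidHom.comp e.toMonoidHom = MonoidHom.id M :=
  MonoidHom.ext fun x => e.symm_apply_apply x

/-- `e ∘ e⁻¹ = id` for a multiplicative equivalence, as monoid homomorphisms. [folklore] -/
private theorem mulEquiv_self_comp_symm_toMonoidHom {M N : Type w} [CommMonoid M] [CommMonoid N] (e : M ≃* N) :
    e.toMonoidHom.comp e.symm.toMonoidHom = MonoidHom.id N :=
  MonoidHom.ext fun y => e.apply_symm_apply y

namespace IsPerfFactorial.Rlf

variable {M N : Type w} [CommMonoid M] [CommMonoid N] (hM : IsPerfFactorial M) (hN : IsPerfFactorial N)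

/-- `M^pf → M^rlf` is injective (the factorization homomorphism is, Def. 2.4 (i)(c)).
[cite: MochizukiFrdI2008, Def. 2.4 (i) p.47] -/
theorem toRealification_injective : Injective hM.toRealification := fun _ _ h =>
  hM.factorMap_injective (congrArg Subtype.val h)

/-- **Row P53/L02a, monoid-theoretic core**: for perf-factorial `M`, `N` and an injective `f : M → N` that
REFLECTS divisibility, `f^rlf : M^rlf → N^rlf` is injective — the image of `M^pf → N^pf → N^rlf` is then
group-saturated and `f^rlf` is its unique extension, so the order-reflection argument of [EtTh] Lemma 3.5 (i)
(`RlfUniversal.lift_injective`) applies.  (False for merely characteristically injective `f`: P53-F1.)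
[cite: MochizukiFrdI2008, Prop. 5.3 p.103] -/
theorem map_injective_of_reflects (f : M →* N) (hinj : Injective f) (hrefl : ∀ a b : M, f a ∣ f b → a ∣ b) :
    Injective (map hM hN f) := by
  refine RlfUniversal.lift_injective hM (hN.toRealification.comp (Perfection.map f)) ?_ ?_ (map hM hN f)
    (map_comp_toRealification hM hN f)
  · exact (toRealification_injective hN).comp (perfectionMap_injective f hinj)
  · rw [isGroupSaturated_iff']
    rintro q _ ⟨a, rfl⟩ _ ⟨b, rfl⟩ hq
    have hdvd : hN.toRealification (Perfection.map f b) ∣ hN.toRealification (Perfection.map f a) :=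
      ⟨q, by rw [MonoidHom.comp_apply, MonoidHom.comp_apply] at hq; rw [← hq, mul_comm]⟩
    rw [RlfCoord.toRealification_dvd_iff hN (PerfectionPrimes.isMonoprime_pfAt hN)] at hdvd
    obtain ⟨c, hc⟩ := Perfection.dvd_of_map_dvd_of_reflects f hrefl hdvd
    refine ⟨c, ?_⟩
    haveI : IsCancelMul hN.Rlf := isCancelMul hN
    apply mul_right_cancel (b := (hN.toRealification.comp (Perfection.map f)) b)
    rw [hq, hc, map_mul, mul_comm]

/-- The realification of a bijective homomorphism of perf-factorial monoids is bijective (`f ↦ f^rlf` is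
functorial: `map_id'`, `map_comp'`). [cite: MochizukiFrdI2008, Prop. 5.3 p.103] -/
theorem map_bijective_of_bijective (f : M →* N) (hf : Bijective f) : Bijective (map hM hN f) := by
  let e : M ≃* N := MulEquiv.ofBijective f hf
  have he : e.toMonoidHom = f := rfl
  have h1 : (map hN hM e.symm.toMonoidHom).comp (map hM hN f) = MonoidHom.id _ := by
    rw [← he, ← map_comp', mulEquiv_symm_comp_toMonoidHom e, map_id']
  have h2 : (map hM hN f).comp (map hN hM e.symm.toMonoidHom) = MonoidHom.id _ := by
    rw [← he, ← map_comp', mulEquiv_self_comp_symm_toMonoidHom e, map_id']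
  exact ⟨Function.LeftInverse.injective (g := map hN hM e.symm.toMonoidHom) (fun x => DFunLike.congr_fun h1 x),
    Function.RightInverse.surjective (g := map hN hM e.symm.toMonoidHom) (fun y => DFunLike.congr_fun h2 y)⟩

end IsPerfFactorial.Rlf

/-! ### P53/L02a: `Φ^rlf` is a monoid on `D` -/

section OnD

variable {D : Type u} [Category.{v} D] {Φ : Dᵒᵖ ⥤ CommMonCat.{w}}

/-- **Prop. 5.3, "the divisor monoid `Φ^rlf`" (row P53/L02a), PROVED under divisibility reflection**: if `Φ` is a
perf-factorial monoid on `D` whose pull-back maps REFLECT divisibility (as for every divisor monoid of the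
motivating examples), then `Φ^rlf = rlfFunctor Φ hΦ` is a monoid on `D`: its pull-backs are the `(Φ(α))^rlf`
(`rlfMap_eq_map`), injective by `map_injective_of_reflects`, injective on characteristics since `M^rlf` is sharp,
and bijective along FSM-morphisms by functoriality.  (Without reflection: FALSE, P53-F1.)
[cite: MochizukiFrdI2008, Prop. 5.3 p.103] -/
theorem isMonoidOn_rlfFunctor_of_reflects (hΦ : ∀ X : Dᵒᵖ, IsPerfFactorial (Φ.obj X)) (hM : IsMonoidOn Φ)
    (hrefl : ∀ ⦃A B : D⦄ (α : B ⟶ A) (a b : Φ.obj (op A)), pull Φ α a ∣ pull Φ α b → a ∣ b) :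
    IsMonoidOn (rlfFunctor Φ hΦ) := by
  refine ⟨fun {A B} α => ?_, fun {A B} α hα => ?_⟩
  · have hinj : Injective (pull (rlfFunctor Φ hΦ) α) := by
      change Injective (rlfMap Φ hΦ α.op)
      rw [IsPerfFactorial.Rlf.rlfMap_eq_map]
      exact IsPerfFactorial.Rlf.map_injective_of_reflects (hΦ (op A)) (hΦ (op B)) _
        (hM.isCharInjective α).1 (hrefl α)
    exact ⟨hinj, associatesMap_injective_of_isSharp (IsPerfFactorial.Rlf.isSharp (hΦ (op B))) hinj⟩
  · change Bijective (rlfMap Φ hΦ α.op)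
    rw [IsPerfFactorial.Rlf.rlfMap_eq_map]
    exact IsPerfFactorial.Rlf.map_bijective_of_bijective (hΦ (op A)) (hΦ (op B)) _ (hM.bijective_of_isFSM α hα)

end OnD

/-! ### P53/L02c: `ℝ · Ψ` is a monoid on `D` -/

namespace RealificationData

variable {D : Type u} [Category.{v} D] {Φ : Dᵒᵖ ⥤ CommMonCat.{w}} (R : RealificationData Φ) (Ψ : GpSubfunctor Φ)

/-- Every generator `r • ι_B(c)` of `ℝ · Ψ(B)` is the pull-back along an FSM-morphism `α : B → A` of a generator of
`ℝ · Ψ(A)`, granted that `Ψ(A) → Ψ(B)` is surjective along `α`. [cite: MochizukiFrdI2008, Prop. 5.3 p.103] -/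
theorem realSpanGen_subset_image {A B : D} (α : B ⟶ A)
    (hΨ : ∀ c ∈ Ψ.carrier B, ∃ c' ∈ Ψ.carrier A, pullGp Φ α c' = c) :
    R.realSpanGen Ψ B ⊆ pullGp R.rlf α '' R.realSpanGen Ψ A := by
  rintro _ ⟨r, c, hc, rfl⟩
  obtain ⟨c', hc', hcc'⟩ := hΨ c hc
  refine ⟨R.rsmul A r (R.toRlfGp A c'), ⟨r, c', hc', rfl⟩, ?_⟩
  rw [R.pullGp_rsmul, ← R.toRlfGp_pullGp, hcc']

/-- Along such an `α : B → A`, `ℝ · Ψ(A)` maps ONTO `ℝ · Ψ(B)`. [cite: MochizukiFrdI2008, Prop. 5.3 p.103] -/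
theorem realSpan_le_map {A B : D} (α : B ⟶ A)
    (hΨ : ∀ c ∈ Ψ.carrier B, ∃ c' ∈ Ψ.carrier A, pullGp Φ α c' = c) :
    (R.realSpan Ψ).carrier B ≤ ((R.realSpan Ψ).carrier A).map (pullGp R.rlf α) := by
  change Subgroup.closure _ ≤ (Subgroup.closure _).map _
  rw [MonoidHom.map_closure]
  exact Subgroup.closure_mono (R.realSpanGen_subset_image Ψ α hΨ)

/-- **Prop. 5.3, "the rational function monoid `ℝ · Φ^birat`" (row P53/L02c), PROVED**: for ANY realification
datum `R` with `Φ^rlf` an integral monoid on `D` and any subfunctor of groups `Ψ ⊆ Φ^gp` whose pull-backs are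
surjective along FSM-morphisms, `ℝ · Ψ` is a monoid on `D`. [cite: MochizukiFrdI2008, Prop. 5.3 p.103] -/
theorem isMonoidOn_realSpan (hR : IsMonoidOn R.rlf) (hint : Objectwise (fun M _ => IsIntegral M) R.rlf)
    (hΨ : ∀ ⦃X Y : D⦄ (f : X ⟶ Y), IsFSM f → ∀ c ∈ Ψ.carrier X, ∃ c' ∈ Ψ.carrier Y, pullGp Φ f c' = c) :
    IsMonoidOn (R.realSpan Ψ).toMonoid := by
  have hinj : ∀ {A B : D} (α : B ⟶ A), Injective (pull (R.realSpan Ψ).toMonoid α) := by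
    intro A B α a b hab
    haveI : IsCancelMul (R.rlf.obj (op A)) := isIntegral_iff_isCancelMul.mp (hint A)
    haveI : IsCancelMul (R.rlf.obj (op B)) := isIntegral_iff_isCancelMul.mp (hint B)
    have hg : Injective (pullGp R.rlf α) := gpMap_injective (pull R.rlf α) (hR.isCharInjective α).1
    exact Subtype.ext (hg (congrArg Subtype.val hab))
  refine ⟨fun {A B} α => ⟨hinj α, ?_⟩, fun {A B} α hα => ⟨hinj α, ?_⟩⟩
  · haveI : Subsingleton (Associates ((R.realSpan Ψ).toMonoid.obj (op A))) :=
      associates_subsingleton_of_group (G := (R.realSpan Ψ).carrier A)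
    exact fun x y _ => Subsingleton.elim x y
  · rintro ⟨y, hy⟩
    obtain ⟨x, hx, hxy⟩ := Subgroup.mem_map.mp (R.realSpan_le_map Ψ α (hΨ α hα) hy)
    exact ⟨⟨x, hx⟩, Subtype.ext hxy⟩

end RealificationData

end Literature.AlgebraicGeometry.Frobenioids

end
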